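import Mathlib
import HarnessLib
import Literature.Analysis.PDE.BanachIndicatrixLaplacianBound

/-!
# Route `UnthreadedDoor`, crux `PoloidalLiouville` (stmt-NavierStokesRegularity-1222), WALL W1 — crux idea «indicatrix-bound»,
# Λ-0b+c bridge, part (T1): the surface measure `sphereArea` is finite; `L²(sphereArea)` bounds from sup bounds

The measure bookkeeping of the M-Lean bridge Λ-0b+c (`IndicatrixLeHessian` ⇐ Polterovich–Sodin 2007 Thm 1.5,
`Cruxes/PoloidalLiouville/IndicatrixSketch.lean` v1.7.5, docstring of `IndicatrixLeHessian`, step (iv)'s `L²` conversion); steps (ii)(iii)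
(homeomorphism / affine-sphere / shift invariance of `banachIndicatrix`) are ns-qj-p1 g8's `…IndicatrixBanachIndicatrixInvariance` (COLLISION
RULING exp-lead g3 2026-08-29T15:31:52Z) and are IMPORTED by the bridge file, not restated here:

* `hausdorffMeasure_two_unitSphere_lt_top`, `sphereArea_univ_lt_top`, `isFiniteMeasure_sphereArea` — the surface measure `sphereArea = μH[2]⌊S²`
  of the typer file is FINITE (the unit sphere lies in the image of the rectangle `[0, π] × [−π, π] ⊆ ℝ × ℝ`, where `μH[2] = volume`, under the
  `6`-Lipschitz spherical coordinates `(θ, φ) ↦ (sin θ cos φ, sin θ sin φ, cos θ)`); NO numerical value of the area is claimed — PS07's constant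
  `k` in `PolterovichSodin2007_indicatrix_sphere` refers to `eLpNorm · 2 sphereArea` with THIS (unnormalised Hausdorff) measure, and the bridge's
  constant is `k · (sphereArea univ)^{1/2} · (absolute)`, so no normalisation is smuggled;
* ★ `eLpNorm_sphereArea_le_of_bound` — `‖g‖_{L²(sphereArea)} ≤ (sphereArea univ)^{1/2} · C` from a pointwise bound `|g| ≤ C` on `S²`.

Pure point-set topology / measure theory; nothing here is an NS statement; ⟨1222⟩ / W1 / NS regularity OPEN — NOT proved.
`--supports stmt-NavierStokesRegularity-1222 --as helper`.  [folklore]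
-/

noncomputable section

-- the summit and its single sub-problem share the name (CONVENTIONS §1)
set_option linter.dupNamespace false

open Set Function Filter Topology MeasureTheory
open scoped ENNReal

namespace Summit.NavierStokesRegularity.NavierStokesRegularity.Theorems.PoloidalLiouville.Indicatrix

open Literature.Analysis.PDE

/-! ### The surface measure `sphereArea = μH[2]⌊S²` is finite -/

/-- A product of two `1`-Lipschitz factors bounded by `1` is `2`-Lipschitz for the max distance. [folklore] -/
private theorem abs_mul_sub_mul_le {a a' b b' d : ℝ} (ha : |a'| ≤ 1) (hb : |b| ≤ 1)
    (haa : |a - a'| ≤ d) (hbb : |b - b'| ≤ d) : |a * b - a' * b'| ≤ 2 * d := by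
  have hd : 0 ≤ d := (abs_nonneg _).trans haa
  have : a * b - a' * b' = (a - a') * b + a' * (b - b') := by ring
  rw [this]
  calc |(a - a') * b + a' * (b - b')| ≤ |(a - a') * b| + |a' * (b - b')| := abs_add_le _ _
    _ = |a - a'| * |b| + |a'| * |b - b'| := by rw [abs_mul, abs_mul]
    _ ≤ d * 1 + 1 * d := by
        gcongr
    _ = 2 * d := by ring

/-- **Spherical coordinates are `6`-Lipschitz**: `(θ, φ) ↦ (sin θ cos φ, sin θ sin φ, cos θ)` from `ℝ × ℝ` (max distance) to `ℝ³`.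
[folklore] -/
theorem lipschitzWith_sphCoord : LipschitzWith 6
    (fun p : ℝ × ℝ => (WithLp.toLp 2 ![Real.sin p.1 * Real.cos p.2, Real.sin p.1 * Real.sin p.2, Real.cos p.1] : (EuclideanSpace ℝ (Fin 3)))) := by
  refine LipschitzWith.of_dist_le_mul fun p q => ?_
  have hθ : |p.1 - q.1| ≤ dist p q := by
    rw [← Real.dist_eq, Prod.dist_eq]; exact le_max_left _ _
  have hφ : |p.2 - q.2| ≤ dist p q := by
    rw [← Real.dist_eq, Prod.dist_eq]; exact le_max_right _ _
  have hsinθ : |Real.sin p.1 - Real.sin q.1| ≤ dist p q :=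
    le_trans (by simpa [Real.dist_eq] using Real.lipschitzWith_sin.dist_le_mul p.1 q.1) hθ
  have hcosθ : |Real.cos p.1 - Real.cos q.1| ≤ dist p q :=
    le_trans (by simpa [Real.dist_eq] using Real.lipschitzWith_cos.dist_le_mul p.1 q.1) hθ
  have hsinφ : |Real.sin p.2 - Real.sin q.2| ≤ dist p q :=
    le_trans (by simpa [Real.dist_eq] using Real.lipschitzWith_sin.dist_le_mul p.2 q.2) hφ
  have hcosφ : |Real.cos p.2 - Real.cos q.2| ≤ dist p q :=
    le_trans (by simpa [Real.dist_eq] using Real.lipschitzWith_cos.dist_le_mul p.2 q.2) hφ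
  -- `‖v‖ ≤ |v₀| + |v₁| + |v₂|` on `ℝ³`
  have hnorm : ∀ v : EuclideanSpace ℝ (Fin 3), ‖v‖ ≤ |v 0| + |v 1| + |v 2| := by
    intro v
    rw [EuclideanSpace.norm_eq, Fin.sum_univ_three]
    simp only [Real.norm_eq_abs, sq_abs]
    have h0 := abs_nonneg (v 0)
    have h1 := abs_nonneg (v 1)
    have h2 := abs_nonneg (v 2)
    calc Real.sqrt (v 0 ^ 2 + v 1 ^ 2 + v 2 ^ 2)
        ≤ Real.sqrt ((|v 0| + |v 1| + |v 2|) ^ 2) := by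
          apply Real.sqrt_le_sqrt
          nlinarith [sq_abs (v 0), sq_abs (v 1), sq_abs (v 2)]
      _ = |v 0| + |v 1| + |v 2| := Real.sqrt_sq (by positivity)
  rw [dist_eq_norm]
  refine (hnorm _).trans ?_
  simp only [PiLp.sub_apply, Matrix.cons_val_zero, Matrix.cons_val_one, Matrix.cons_val_two,
    Matrix.tail_cons, Matrix.head_cons]
  have h0 := abs_mul_sub_mul_le (Real.abs_sin_le_one q.1) (Real.abs_cos_le_one p.2) hsinθ hcosφ
  have h1 := abs_mul_sub_mul_le (Real.abs_sin_le_one q.1) (Real.abs_sin_le_one p.2) hsinθ hsinφ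
  have hd : 0 ≤ dist p q := dist_nonneg
  push_cast
  linarith

/-- **The unit sphere is covered by spherical coordinates** from the rectangle `[0, π] × [−π, π]`
(`θ = arccos σ₂`, `φ = arg (σ₀ + i σ₁)`). [folklore] -/
theorem unitSphere_subset_image_sphCoord :
    Metric.sphere (0 : (EuclideanSpace ℝ (Fin 3))) 1 ⊆
      (fun p : ℝ × ℝ => (WithLp.toLp 2 ![Real.sin p.1 * Real.cos p.2, Real.sin p.1 * Real.sin p.2, Real.cos p.1] : (EuclideanSpace ℝ (Fin 3)))) ''
        (Icc 0 Real.pi ×ˢ Icc (-Real.pi) Real.pi) := by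
  intro σ hσ
  rw [Metric.mem_sphere, dist_zero_right] at hσ
  have hsq : σ 0 ^ 2 + σ 1 ^ 2 + σ 2 ^ 2 = 1 := by
    have h := EuclideanSpace.norm_sq_eq σ
    rw [hσ, one_pow, Fin.sum_univ_three] at h
    simp only [Real.norm_eq_abs, sq_abs] at h
    linarith
  have h2le : |σ 2| ≤ 1 := by
    rw [abs_le]
    constructor <;> nlinarith [sq_nonneg (σ 0), sq_nonneg (σ 1)]
  set θ := Real.arccos (σ 2) with hθ
  set z : ℂ := ⟨σ 0, σ 1⟩ with hz
  set φ := Complex.arg z with hφ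
  have hcosθ : Real.cos θ = σ 2 := Real.cos_arccos (abs_le.1 h2le).1 (abs_le.1 h2le).2
  have hnormz : ‖z‖ = Real.sqrt (1 - σ 2 ^ 2) := by
    rw [Complex.norm_eq_sqrt_sq_add_sq]
    congr 1
    simp only [hz]
    linarith
  have hsinθ : Real.sin θ = ‖z‖ := by rw [hnormz, hθ, Real.sin_arccos]
  refine ⟨(θ, φ), ⟨⟨Real.arccos_nonneg _, Real.arccos_le_pi _⟩,
    ⟨(Complex.neg_pi_lt_arg z).le, Complex.arg_le_pi z⟩⟩, ?_⟩
  -- componentwise identification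
  have hre : Real.sin θ * Real.cos φ = σ 0 := by
    by_cases hz0 : z = 0
    · have h00 : σ 0 = 0 := by simpa [hz] using congrArg Complex.re hz0
      rw [hsinθ, hz0, norm_zero, zero_mul, h00]
    · rw [hsinθ, hφ, Complex.cos_arg hz0]
      field_simp
      simp [hz]
  have him : Real.sin θ * Real.sin φ = σ 1 := by
    by_cases hz0 : z = 0
    · have h10 : σ 1 = 0 := by simpa [hz] using congrArg Complex.im hz0
      rw [hsinθ, hz0, norm_zero, zero_mul, h10]
    · rw [hsinθ, hφ, Complex.sin_arg]
      field_simp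
      simp [hz]
  ext i
  fin_cases i
  · exact hre
  · exact him
  · exact hcosθ

/-- **`μH[2](S²) < ∞`**: the two-dimensional Hausdorff measure of the unit sphere of `ℝ³` is finite (Lipschitz image of a
bounded rectangle of `ℝ × ℝ`, where `μH[2] = volume`). [folklore] -/
theorem hausdorffMeasure_two_unitSphere_lt_top :
    (Measure.hausdorffMeasure 2 : Measure (EuclideanSpace ℝ (Fin 3))) (Metric.sphere (0 : (EuclideanSpace ℝ (Fin 3))) 1) < ∞ := by
  set R : Set (ℝ × ℝ) := Icc 0 Real.pi ×ˢ Icc (-Real.pi) Real.pi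
  have hR : (Measure.hausdorffMeasure 2 : Measure (ℝ × ℝ)) R < ∞ := by
    rw [MeasureTheory.hausdorffMeasure_prod_real, Measure.volume_eq_prod, Measure.prod_prod,
      Real.volume_Icc, Real.volume_Icc]
    exact ENNReal.mul_lt_top ENNReal.ofReal_lt_top ENNReal.ofReal_lt_top
  have himg := lipschitzWith_sphCoord.lipschitzOnWith (s := R) |>.hausdorffMeasure_image_le
    (d := 2) (by norm_num)
  calc (Measure.hausdorffMeasure 2 : Measure (EuclideanSpace ℝ (Fin 3))) (Metric.sphere (0 : (EuclideanSpace ℝ (Fin 3))) 1)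
      ≤ (Measure.hausdorffMeasure 2 : Measure (EuclideanSpace ℝ (Fin 3)))
          ((fun p : ℝ × ℝ =>
            (WithLp.toLp 2 ![Real.sin p.1 * Real.cos p.2, Real.sin p.1 * Real.sin p.2, Real.cos p.1] : (EuclideanSpace ℝ (Fin 3)))) '' R) :=
        measure_mono unitSphere_subset_image_sphCoord
    _ ≤ (6 : ℝ≥0∞) ^ (2 : ℝ) * (Measure.hausdorffMeasure 2 : Measure (ℝ × ℝ)) R := by
        exact_mod_cast himg
    _ < ∞ := ENNReal.mul_lt_top (ENNReal.rpow_lt_top_of_nonneg (by norm_num) (by simp)) hR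

/-- **`sphereArea univ < ∞`**: the surface measure of the typer file is finite (its total mass is `μH[2](S²)`; no numerical
value is claimed). [folklore] -/
theorem sphereArea_univ_lt_top : sphereArea Set.univ < ∞ := by
  rw [sphereArea, Measure.restrict_apply_univ]
  exact hausdorffMeasure_two_unitSphere_lt_top

/-- `sphereArea` is a finite measure (stated as a theorem, not an instance). [folklore] -/
theorem isFiniteMeasure_sphereArea : IsFiniteMeasure sphereArea :=
  ⟨sphereArea_univ_lt_top⟩

/-- ★ **`L²(sphereArea)` norm from a pointwise bound on `S²`**: if `|g σ| ≤ C` for every `σ ∈ S²` then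
`‖g‖_{L²(sphereArea)} ≤ (sphereArea univ)^{1/2} · C`. [folklore] -/
theorem eLpNorm_sphereArea_le_of_bound {g : (EuclideanSpace ℝ (Fin 3)) → ℝ} {C : ℝ}
    (h : ∀ σ ∈ Metric.sphere (0 : (EuclideanSpace ℝ (Fin 3))) 1, |g σ| ≤ C) :
    eLpNorm g 2 sphereArea ≤ sphereArea Set.univ ^ (2 : ℝ)⁻¹ * ENNReal.ofReal C := by
  have hae : ∀ᵐ σ ∂sphereArea, ‖g σ‖ ≤ C := by
    rw [sphereArea]
    exact ae_restrict_of_forall_mem Metric.isClosed_sphere.measurableSet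
      fun σ hσ => by rw [Real.norm_eq_abs]; exact h σ hσ
  have := eLpNorm_le_of_ae_bound (p := (2 : ℝ≥0∞)) hae
  simpa using this

end Summit.NavierStokesRegularity.NavierStokesRegularity.Theorems.PoloidalLiouville.Indicatrix

end
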